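import Summits.AtomisticToContinuum.Crystallization.Theorems.ExcessDecayLiouvillePhononStabilityCertCurv

/-!
# Near-certificate layer V5-c3: the curvature dominators are inclusion monotone in the box (lead c2, vertex scheme)

Support file for crux `PhononStability` (stmt-AtomisticToContinuum-9333), line `contragredient-window-collapse`.

Node sharing in the vertex scheme: a grid node certifies its value against the defect built from the curvature
dominators of ITS `2h`-box, while a cell uses the dominators of the CELL; since every cell lies in the `2h`-box of each
of its vertices, the cell theorem needs `D(cell) ≤ D(node box)`.  This holds because every stage of `curvD` is a
natural interval extension (layer V5-c1 proved the primitives monotone): `rhoIvl_mono`, `ipcIvl_mono`,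
`d2Ivl_mono`, `stildeIvl_mono`, `frameIvl_mono`, `curvDiag_mono`, whence `curvD_mono` and the quadratic-form
comparison `curvW_mono`.  Nonemptiness side conditions are discharged by a witness point of the smaller box.
-/

noncomputable section

open scoped BigOperators
open Set Function
open Summit.AtomisticToContinuum.Crystallization.Theorems.PhononStabilityNegative

namespace Summit.AtomisticToContinuum.Crystallization.Theorems.PhononStabilityCWC.Cert

local notation "E3" => EuclideanSpace ℝ (Fin 3)

namespace Ivl

/-- `mul` is monotone, nonemptiness by witnesses. [folklore] -/
theorem mul_mono_mem {I I' J J' : Ivl} {x y : ℝ} (hx : I.mem x) (hy : J.mem y) (hI : sub I I' = true)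
    (hJ : sub J J' = true) : sub (mul I J) (mul I' J') = true :=
  mul_mono (ne_of_mem hx) (ne_of_mem hy) hI hJ

/-- `smul` is monotone, nonemptiness by a witness. [folklore] -/
theorem smul_mono_mem (a : ℚ) {I I' : Ivl} {x : ℝ} (hx : I.mem x) (hI : sub I I' = true) :
    sub (smul a I) (smul a I') = true :=
  smul_mono a (ne_of_mem hx) hI

/-- `sub` is reflexive. [folklore] -/
theorem sub_refl (I : Ivl) : sub I I = true := by rw [sub_iff]; exact ⟨le_rfl, le_rfl⟩

/-- `sub` is transitive. [folklore] -/
theorem sub_trans {I J K : Ivl} (h1 : sub I J = true) (h2 : sub J K = true) : sub I K = true := by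
  rw [sub_iff] at *; exact ⟨h2.1.trans h1.1, h1.2.trans h2.2⟩

end Ivl

/-! ## Stage-wise monotonicity -/

/-- the box inclusion hypothesis on a list of variables, unpacked. [folklore] -/
theorem Box.subOn_iff {vars : List ℕ} {B B' : Box} : Box.subOn vars B B' = true ↔ ∀ a ∈ vars, Ivl.sub (B a) (B' a) = true := by
  simp [Box.subOn]

/-- `rhoIvl` is monotone. [folklore] -/
theorem rhoIvl_mono (ρbar : ℚ) (P : SPoly) {B B' : Box} {y : ℕ → ℝ} (hy : B.mem y)
    (hs : ∀ a ∈ spVars P, Ivl.sub (B a) (B' a) = true) : Ivl.sub (rhoIvl ρbar P B) (rhoIvl ρbar P B') = true :=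
  Ivl.add_mono (Ivl.sub_refl _) (spIvl_mono hy P hs)

/-- `ipcIvl` is monotone on positive intervals. [folklore] -/
theorem ipcIvl_mono (a : ℚ) (m : ℕ) (b : ℚ) (n : ℕ) {I I' : Ivl} {ρ : ℝ} (hρ : I.mem ρ) (hI : Ivl.sub I I' = true)
    (hpos : 0 < I'.lo) : Ivl.sub (ipcIvl a m b n I) (ipcIvl a m b n I') = true := by
  have hposI : 0 < I.lo := lt_of_lt_of_le hpos (Ivl.sub_iff.mp hI).1
  unfold ipcIvl
  exact Ivl.add_mono (Ivl.smul_mono_mem a (Ivl.mem_powInv m hposI hρ) (Ivl.powInv_mono m (Ivl.ne_of_mem hρ) hI hpos))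
    (Ivl.smul_mono_mem b (Ivl.mem_powInv n hposI hρ) (Ivl.powInv_mono n (Ivl.ne_of_mem hρ) hI hpos))

/-- `d2Ivl` is monotone (witnesses for every argument). [folklore] -/
theorem d2Ivl_mono {J0 J1 J2 R1 Q2 K K1 K2 J0' J1' J2' R1' Q2' K' K1' K2' : Ivl} {φ0 φ1 φ2 ρ1 p2 k k1 k2 : ℝ}
    (h0 : J0.mem φ0) (h1 : J1.mem φ1) (h2 : J2.mem φ2) (hr : R1.mem ρ1) (hq : Q2.mem p2) (hk : K.mem k)
    (hk1 : K1.mem k1) (hk2 : K2.mem k2)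
    (s0 : Ivl.sub J0 J0' = true) (s1 : Ivl.sub J1 J1' = true) (s2 : Ivl.sub J2 J2' = true) (sr : Ivl.sub R1 R1' = true)
    (sq : Ivl.sub Q2 Q2' = true) (sk : Ivl.sub K K' = true) (sk1 : Ivl.sub K1 K1' = true) (sk2 : Ivl.sub K2 K2' = true) :
    Ivl.sub (d2Ivl J0 J1 J2 R1 Q2 K K1 K2) (d2Ivl J0' J1' J2' R1' Q2' K' K1' K2') = true := by
  unfold d2Ivl
  have mRR := Ivl.mem_mul hr hr
  have mA := Ivl.mem_mul h2 mRR
  have mQJ := Ivl.mem_mul hq h1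
  have mB := Ivl.mem_smul 2 mQJ
  have mAB := Ivl.mem_add mA mB
  have mJR := Ivl.mem_mul h1 hr
  have mJRK := Ivl.mem_mul mJR hk1
  have mJK := Ivl.mem_mul h0 hk2
  refine Ivl.add_mono (Ivl.add_mono (Ivl.mul_mono_mem mAB hk (Ivl.add_mono (Ivl.mul_mono_mem h2 mRR s2
    (Ivl.mul_mono_mem hr hr sr sr)) (Ivl.smul_mono_mem 2 mQJ (Ivl.mul_mono_mem hq h1 sq s1))) sk)
    (Ivl.smul_mono_mem 2 mJRK (Ivl.mul_mono_mem mJR hk1 (Ivl.mul_mono_mem h1 hr s1 sr) sk1)))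
    (Ivl.smul_mono_mem 2 mJK (Ivl.mul_mono_mem h0 hk2 s0 sk2))

/-- the variables a (class, variable) enclosure depends on -/
def curvVars (P : SPoly) (Z Λ : List (Mono × Mat)) (v : ℕ) : List ℕ :=
  spVars P ++ spVars (spD P v) ++ spVars (spCoeff P v 2) ++ mpVars Z ++ mpVars (mpD Z v) ++ mpVars (mpCoeff Z v 2)
    ++ mpVars Λ ++ mpVars (mpD Λ v) ++ mpVars (mpCoeff Λ v 2)

/-- **`stildeIvl` is monotone.** [folklore] -/
theorem stildeIvl_mono (ρbar : ℚ) (P : SPoly) (Z Λ : List (Mono × Mat)) (v : ℕ) {B B' : Box} {y : ℕ → ℝ} (hy : B.mem y)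
    (hs : ∀ a ∈ curvVars P Z Λ v, Ivl.sub (B a) (B' a) = true) (hpos : 0 < (rhoIvl ρbar P B').lo) (i j : Fin 3) :
    Ivl.sub (stildeIvl ρbar P Z Λ v B i j) (stildeIvl ρbar P Z Λ v B' i j) = true := by
  have hv : ∀ (l : List ℕ), (∀ a, a ∈ l → a ∈ curvVars P Z Λ v) → ∀ a ∈ l, Ivl.sub (B a) (B' a) = true :=
    fun l hl a ha => hs a (hl a ha)
  have sP := hv (spVars P) (fun a ha => by simp [curvVars, ha])
  have sD := hv (spVars (spD P v)) (fun a ha => by simp [curvVars, ha])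
  have s2 := hv (spVars (spCoeff P v 2)) (fun a ha => by simp [curvVars, ha])
  have sZ := hv (mpVars Z) (fun a ha => by simp [curvVars, ha])
  have sZ1 := hv (mpVars (mpD Z v)) (fun a ha => by simp [curvVars, ha])
  have sZ2 := hv (mpVars (mpCoeff Z v 2)) (fun a ha => by simp [curvVars, ha])
  have sΛ := hv (mpVars Λ) (fun a ha => by simp [curvVars, ha])
  have sΛ1 := hv (mpVars (mpD Λ v)) (fun a ha => by simp [curvVars, ha])
  have sΛ2 := hv (mpVars (mpCoeff Λ v 2)) (fun a ha => by simp [curvVars, ha])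
  have hρsub := rhoIvl_mono ρbar P hy sP
  have hposB : 0 < (rhoIvl ρbar P B).lo := lt_of_lt_of_le hpos (Ivl.sub_iff.mp hρsub).1
  have hρmem := mem_rhoIvl ρbar P hy
  obtain ⟨m0, m1, m2, m3, m4, m5⟩ := mem_phiIvls hposB hρmem
  have f0 : Ivl.sub (phiIvls (rhoIvl ρbar P B)).1 (phiIvls (rhoIvl ρbar P B')).1 = true :=
    ipcIvl_mono 14 8 (-8) 5 hρmem hρsub hpos
  have f1 : Ivl.sub (phiIvls (rhoIvl ρbar P B)).2.1 (phiIvls (rhoIvl ρbar P B')).2.1 = true :=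
    ipcIvl_mono (-112) 9 40 6 hρmem hρsub hpos
  have f2 : Ivl.sub (phiIvls (rhoIvl ρbar P B)).2.2.1 (phiIvls (rhoIvl ρbar P B')).2.2.1 = true :=
    ipcIvl_mono 1008 10 (-240) 7 hρmem hρsub hpos
  have f3 : Ivl.sub (phiIvls (rhoIvl ρbar P B)).2.2.2.1 (phiIvls (rhoIvl ρbar P B')).2.2.2.1 = true :=
    ipcIvl_mono (-1) 7 1 4 hρmem hρsub hpos
  have f4 : Ivl.sub (phiIvls (rhoIvl ρbar P B)).2.2.2.2.1 (phiIvls (rhoIvl ρbar P B')).2.2.2.2.1 = true :=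
    ipcIvl_mono 7 8 (-4) 5 hρmem hρsub hpos
  have f5 : Ivl.sub (phiIvls (rhoIvl ρbar P B)).2.2.2.2.2 (phiIvls (rhoIvl ρbar P B')).2.2.2.2.2 = true :=
    ipcIvl_mono (-56) 9 20 6 hρmem hρsub hpos
  unfold stildeIvl
  exact Ivl.add_mono
    (d2Ivl_mono m0 m1 m2 (mem_spIvl hy _) (mem_spIvl hy _) (mem_mpIvl hy Z i j) (mem_mpIvl hy _ i j) (mem_mpIvl hy _ i j)
      f0 f1 f2 (spIvl_mono hy _ sD) (spIvl_mono hy _ s2) (mpIvl_mono hy Z i j sZ) (mpIvl_mono hy _ i j sZ1)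
      (mpIvl_mono hy _ i j sZ2))
    (d2Ivl_mono m3 m4 m5 (mem_spIvl hy _) (mem_spIvl hy _) (mem_mpIvl hy Λ i j) (mem_mpIvl hy _ i j) (mem_mpIvl hy _ i j)
      f3 f4 f5 (spIvl_mono hy _ sD) (spIvl_mono hy _ s2) (mpIvl_mono hy Λ i j sΛ) (mpIvl_mono hy _ i j sΛ1)
      (mpIvl_mono hy _ i j sΛ2))

/-- the inner fold of `frameIvl` is monotone. [folklore] -/
theorem frameIvl_inner_mono (U : Mat) {S S' : Fin 3 → Fin 3 → Ivl} {Sr : Fin 3 → Fin 3 → ℝ} (hm : ∀ i j, (S i j).mem (Sr i j))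
    (hs : ∀ i j, Ivl.sub (S i j) (S' i j) = true) (a b i : Fin 3) {acc acc' : Ivl} (hacc : Ivl.sub acc acc' = true)
    (l : List (Fin 3)) :
    Ivl.sub (l.foldr (fun j acc'' => Ivl.add (Ivl.smul (U i a * U j b) (S i j)) acc'') acc)
      (l.foldr (fun j acc'' => Ivl.add (Ivl.smul (U i a * U j b) (S' i j)) acc'') acc') = true := by
  induction l with
  | nil => simpa using hacc
  | cons j l ih =>
      simp only [List.foldr_cons]
      exact Ivl.add_mono (Ivl.smul_mono_mem _ (hm i j) (hs i j)) ih

/-- `frameIvl` is monotone. [folklore] -/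
theorem frameIvl_mono (U : Mat) {S S' : Fin 3 → Fin 3 → Ivl} {Sr : Fin 3 → Fin 3 → ℝ} (hm : ∀ i j, (S i j).mem (Sr i j))
    (hs : ∀ i j, Ivl.sub (S i j) (S' i j) = true) (a b : Fin 3) : Ivl.sub (frameIvl U S a b) (frameIvl U S' a b) = true := by
  unfold frameIvl
  have key : ∀ l : List (Fin 3), Ivl.sub
      (l.foldr (fun i acc => (List.finRange 3).foldr (fun j acc' => Ivl.add (Ivl.smul (U i a * U j b) (S i j)) acc') acc)
        (Ivl.const 0))
      (l.foldr (fun i acc => (List.finRange 3).foldr (fun j acc' => Ivl.add (Ivl.smul (U i a * U j b) (S' i j)) acc') acc)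
        (Ivl.const 0)) = true := by
    intro l
    induction l with
    | nil => simpa using Ivl.sub_refl _
    | cons i l ih =>
        simp only [List.foldr_cons]
        exact frameIvl_inner_mono U hm hs a b i ih (List.finRange 3)
  exact key _

/-- `curvDiag` is monotone. [folklore] -/
theorem curvDiag_mono {S S' : Fin 3 → Fin 3 → Ivl} {Sr : Fin 3 → Fin 3 → ℝ} (hm : ∀ a b, (S a b).mem (Sr a b))
    (hs : ∀ a b, Ivl.sub (S a b) (S' a b) = true) (a : Fin 3) : curvDiag S a ≤ curvDiag S' a := by
  unfold curvDiag
  refine max_le_max le_rfl (add_le_add (Ivl.hi_mono (hs a a)) (Finset.sum_le_sum fun b _ => ?_))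
  have h1 := Ivl.mag_mono (Ivl.ne_of_mem (hm a b)) (hs a b)
  have h2 := Ivl.mag_mono (Ivl.ne_of_mem (hm b a)) (hs b a)
  linarith

/-- **THE CURVATURE DOMINATOR DATA IS INCLUSION MONOTONE IN THE BOX.** [folklore] -/
theorem curvD_mono (ρbar : ℚ) (P : SPoly) (Z Λ : List (Mono × Mat)) (v : ℕ) (U : Mat) {B B' : Box} {y : ℕ → ℝ}
    (hy : B.mem y) (hs : ∀ a ∈ curvVars P Z Λ v, Ivl.sub (B a) (B' a) = true) (hpos : 0 < (rhoIvl ρbar P B').lo)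
    (a : Fin 3) : curvD ρbar P Z Λ v U B a ≤ curvD ρbar P Z Λ v U B' a := by
  have hρsub := rhoIvl_mono ρbar P hy fun a ha => hs a (by simp [curvVars, ha])
  have hposB : 0 < (rhoIvl ρbar P B).lo := lt_of_lt_of_le hpos (Ivl.sub_iff.mp hρsub).1
  have hmS : ∀ i j, (stildeIvl ρbar P Z Λ v B i j).mem (stilde ρbar P Z Λ v y i j) :=
    fun i j => mem_stildeIvl ρbar P Z Λ v hposB hy i j
  have hsS : ∀ i j, Ivl.sub (stildeIvl ρbar P Z Λ v B i j) (stildeIvl ρbar P Z Λ v B' i j) = true :=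
    fun i j => stildeIvl_mono ρbar P Z Λ v hy hs hpos i j
  unfold curvD
  exact curvDiag_mono (fun a b => mem_frameIvl U hmS a b) (fun a b => frameIvl_mono U hmS hsS a b) a

/-- **the dominator matrices compare as quadratic forms:** `D ≤ D′ ⇒ W(D) ⪯ W(D′)`. [folklore] -/
theorem curvW_mono {D D' : Fin 3 → ℚ} (h : ∀ a, D a ≤ D' a) (Uinv : Mat) :
    MatLE (fun i j => (curvW D Uinv i j : ℝ)) (fun i j => (curvW D' Uinv i j : ℝ)) := by
  intro u
  rw [bilR_curvW, bilR_curvW]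
  exact Finset.sum_le_sum fun a _ => mul_le_mul_of_nonneg_right (by exact_mod_cast h a) (sq_nonneg _)

/-- pair forms of the dominators compare. [folklore] -/
theorem pairEvalR_curvW_mono {w : Label → E3} (hw : (support w).Finite) (c : BondClass) {D D' : Fin 3 → ℚ}
    (h : ∀ a, D a ≤ D' a) (Uinv : Mat) :
    pairEvalR c (fun i j => (curvW D Uinv i j : ℝ)) w ≤ pairEvalR c (fun i j => (curvW D' Uinv i j : ℝ)) w :=
  pairEvalR_mono hw c (curvW_mono h Uinv)

/-- Anchor of this support file (registered stub of the line skeleton, lead c2): reflexivity of interval inclusion. -/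
theorem stub_certCurvMono : Ivl.sub ⟨0, 1⟩ ⟨0, 1⟩ = true := by
  decide +kernel

end Summit.AtomisticToContinuum.Crystallization.Theorems.PhononStabilityCWC.Cert

end
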